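import Summits.AtomisticToContinuum.Crystallization.Theorems.ExcessDecayLiouvilleHcpLiouvilleBlowdownGalerkinLimit
import Summits.AtomisticToContinuum.Crystallization.Theorems.ExcessDecayLiouvilleHcpLiouvilleBlowdownGreenL2

/-!
# `ExcessDecayLiouville.HcpLiouville` (stmt-AtomisticToContinuum-9332), line `Sketch` v4: the Galerkin limit, III — linearity

Helper file for sub-goal `blowdown_greenSolve` (H2 of stub `stub_green`) of crux stmt-AtomisticToContinuum-9332
(`Summit.AtomisticToContinuum.Crystallization.Theses.ExcessDecayLiouville.HcpLiouville`), line `Sketch`, skeleton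
v4.  Pointwise limits of Galerkin families inherit, by finite-level uniqueness, (v)/(vii) LINEARITY in the
right-hand side, (vi) COVARIANCE under lattice translations (the translated family is the Galerkin family of the
translated exhaustion, which is cofinal), (ix) SELF-REPRODUCTION of finitely supported fields (`U V = φ` once
`V ⊇ supp φ`), and (viii) COUNTABLE ADDITIVITY under a summable family of admissibility bounds (at the finite level the
solution map is a linear map of the finitely many data, hence continuous; then Tannery along the net with the
capacity domination `‖U V p‖ ≤ √C · Nₙ/κ`).  Admissibility is closed under countable sums (`adm_of_hasSum`;
the cone property is `Blowdown.adm_add/adm_smul` of `…BlowdownGreenL2`).  All `[folklore]`; a `--supports` helper, nothing here closes an item.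
-/

noncomputable section

namespace Summit.AtomisticToContinuum.Crystallization.Theorems.ExcessDecayLiouville

open scoped BigOperators Topology Classical InnerProductSpace RealInnerProductSpace
open Filter
open Literature.MathematicalPhysics.StatisticalMechanics
open Summit.AtomisticToContinuum.Crystallization.Theses.ExcessDecayLiouville
open Summit.AtomisticToContinuum.Crystallization.Theorems.PhononStabilityNegative

section

variable {t : Fin 2 → EuclideanSpace ℝ (Fin 3)} {A : EuclideanSpace ℝ (Fin 3) →L[ℝ] EuclideanSpace ℝ (Fin 3)}
  {κ : ℝ} {C : ℝ}

/-! ## Admissible right-hand sides: closure properties -/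

/-- The pairing `Σ'⟪f, w⟫` with a finitely supported `w` is a finite sum over the support. [folklore] -/
theorem tsum_inner_eq_sum (f : EuclideanSpace ℝ (Fin 3) → EuclideanSpace ℝ (Fin 3))
    {w : EuclideanSpace ℝ (Fin 3) → EuclideanSpace ℝ (Fin 3)} (hw : (Function.support w).Finite) :
    ∑' p : Sites₀ t A, ⟪f p, w p⟫ = ∑ p ∈ (finite_support_sites (t := t) (A := A) hw).toFinset, ⟪f p, w p⟫ := by
  refine tsum_eq_sum fun p hp => ?_
  have : w p = 0 := by
    by_contra h
    exact hp ((Set.Finite.mem_toFinset _).2 h)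
  rw [this, inner_zero_right]

/-- **Admissibility of countable sums**: if `F n` is admissible with bound `Nₙ`, `Σ Nₙ < ∞`, and `Σ_n F n p = f p` at
every site, then `f` is admissible with bound `Σ' Nₙ`. [folklore] -/
theorem adm_of_hasSum {ι : Type} {F : ι → EuclideanSpace ℝ (Fin 3) → EuclideanSpace ℝ (Fin 3)} {Nn : ι → ℝ}
    {f : EuclideanSpace ℝ (Fin 3) → EuclideanSpace ℝ (Fin 3)} (hs : Summable Nn)
    (hF : ∀ n, ∀ w : EuclideanSpace ℝ (Fin 3) → EuclideanSpace ℝ (Fin 3), (Function.support w).Finite →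
      Function.support w ⊆ Sites₀ t A → |∑' p : Sites₀ t A, ⟪F n p, w p⟫| ≤ Nn n * Real.sqrt (nnForm t A w))
    (hsum : ∀ p : Sites₀ t A, HasSum (fun n => F n p) (f p)) :
    ∀ w : EuclideanSpace ℝ (Fin 3) → EuclideanSpace ℝ (Fin 3), (Function.support w).Finite →
      Function.support w ⊆ Sites₀ t A →
        |∑' p : Sites₀ t A, ⟪f p, w p⟫| ≤ (∑' n, Nn n) * Real.sqrt (nnForm t A w) := by
  intro w hw hwS
  set T := (finite_support_sites (t := t) (A := A) hw).toFinset with hT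
  have e2 : ∀ n, ∑' p : Sites₀ t A, ⟪F n p, w p⟫ = ∑ p ∈ T, ⟪F n p, w p⟫ :=
    fun n => tsum_inner_eq_sum (t := t) (A := A) (F n) hw
  have h3 : HasSum (fun n => ∑ p ∈ T, ⟪F n p, w p⟫) (∑ p ∈ T, ⟪f p, w p⟫) := by
    refine hasSum_sum fun p _ => ?_
    have h := (hsum p).mapL (innerSL ℝ (w p))
    simp only [innerSL_apply_apply] at h
    simpa only [real_inner_comm] using h
  have h4 : ∀ n, ‖∑ p ∈ T, ⟪F n p, w p⟫‖ ≤ Nn n * Real.sqrt (nnForm t A w) := fun n => by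
    rw [Real.norm_eq_abs, ← e2 n]
    exact hF n w hw hwS
  have hbs : Summable (fun n => Nn n * Real.sqrt (nnForm t A w)) := hs.mul_right _
  have hns : Summable (fun n => ‖∑ p ∈ T, ⟪F n p, w p⟫‖) :=
    Summable.of_nonneg_of_le (fun n => norm_nonneg _) h4 hbs
  rw [tsum_inner_eq_sum (t := t) (A := A) f hw, ← h3.tsum_eq]
  calc |∑' n, ∑ p ∈ T, ⟪F n p, w p⟫| = ‖∑' n, ∑ p ∈ T, ⟪F n p, w p⟫‖ := (Real.norm_eq_abs _).symm
    _ ≤ ∑' n, ‖∑ p ∈ T, ⟪F n p, w p⟫‖ := norm_tsum_le_tsum_norm hns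
    _ ≤ ∑' n, Nn n * Real.sqrt (nnForm t A w) := hns.tsum_le_tsum h4 hbs
    _ = (∑' n, Nn n) * Real.sqrt (nnForm t A w) := tsum_mul_right

/-! ## Linearity, self-reproduction and covariance of the limits -/

/-- **Homogeneity of the limit** (clause (v)). [folklore] -/
theorem lim_smul (hA : Adm₀ A) (hI : Inner₀ t A) (hκ : 0 < κ) (hPS : Blowdown.PSIneq κ t A)
    {f : EuclideanSpace ℝ (Fin 3) → EuclideanSpace ℝ (Fin 3)} (c : ℝ)
    {U U' : Finset (Sites₀ t A) → EuclideanSpace ℝ (Fin 3) → EuclideanSpace ℝ (Fin 3)}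
    (hU : ∀ V : Finset (Sites₀ t A), Function.support (U V) ⊆ Subtype.val '' (V : Set (Sites₀ t A)) ∧
      ∀ p : Sites₀ t A, p ∈ V →
        ∑' q : Sites₀ t A, forceConst ((p : EuclideanSpace ℝ (Fin 3)) - q) (U V p - U V q) = f p)
    (hU' : ∀ V : Finset (Sites₀ t A), Function.support (U' V) ⊆ Subtype.val '' (V : Set (Sites₀ t A)) ∧
      ∀ p : Sites₀ t A, p ∈ V →
        ∑' q : Sites₀ t A, forceConst ((p : EuclideanSpace ℝ (Fin 3)) - q) (U' V p - U' V q) = (c • f) p)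
    {G G' : EuclideanSpace ℝ (Fin 3) → EuclideanSpace ℝ (Fin 3)}
    (hG : ∀ p : Sites₀ t A, Tendsto (fun V : Finset (Sites₀ t A) => U V p) atTop (𝓝 (G p)))
    (hG' : ∀ p : Sites₀ t A, Tendsto (fun V : Finset (Sites₀ t A) => U' V p) atTop (𝓝 (G' p))) (p : Sites₀ t A) :
    G' p = c • G p := by
  have heq : ∀ V, U' V = c • U V := fun V => galerkin_smul hA hI hκ hPS c (hU V).1 (hU' V).1 (hU V).2 (hU' V).2
  have h1 : Tendsto (fun V : Finset (Sites₀ t A) => U' V p) atTop (𝓝 (c • G p)) := by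
    refine ((hG p).const_smul c).congr fun V => ?_
    rw [heq V, Pi.smul_apply]
  exact tendsto_nhds_unique (hG' p) h1

/-- **Additivity of the limit** (clause (vii)). [folklore] -/
theorem lim_add (hA : Adm₀ A) (hI : Inner₀ t A) (hκ : 0 < κ) (hPS : Blowdown.PSIneq κ t A)
    {f g : EuclideanSpace ℝ (Fin 3) → EuclideanSpace ℝ (Fin 3)}
    {U U' U'' : Finset (Sites₀ t A) → EuclideanSpace ℝ (Fin 3) → EuclideanSpace ℝ (Fin 3)}
    (hU : ∀ V : Finset (Sites₀ t A), Function.support (U V) ⊆ Subtype.val '' (V : Set (Sites₀ t A)) ∧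
      ∀ p : Sites₀ t A, p ∈ V →
        ∑' q : Sites₀ t A, forceConst ((p : EuclideanSpace ℝ (Fin 3)) - q) (U V p - U V q) = f p)
    (hU' : ∀ V : Finset (Sites₀ t A), Function.support (U' V) ⊆ Subtype.val '' (V : Set (Sites₀ t A)) ∧
      ∀ p : Sites₀ t A, p ∈ V →
        ∑' q : Sites₀ t A, forceConst ((p : EuclideanSpace ℝ (Fin 3)) - q) (U' V p - U' V q) = g p)
    (hU'' : ∀ V : Finset (Sites₀ t A), Function.support (U'' V) ⊆ Subtype.val '' (V : Set (Sites₀ t A)) ∧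
      ∀ p : Sites₀ t A, p ∈ V →
        ∑' q : Sites₀ t A, forceConst ((p : EuclideanSpace ℝ (Fin 3)) - q) (U'' V p - U'' V q) = (f + g) p)
    {G G' G'' : EuclideanSpace ℝ (Fin 3) → EuclideanSpace ℝ (Fin 3)}
    (hG : ∀ p : Sites₀ t A, Tendsto (fun V : Finset (Sites₀ t A) => U V p) atTop (𝓝 (G p)))
    (hG' : ∀ p : Sites₀ t A, Tendsto (fun V : Finset (Sites₀ t A) => U' V p) atTop (𝓝 (G' p)))
    (hG'' : ∀ p : Sites₀ t A, Tendsto (fun V : Finset (Sites₀ t A) => U'' V p) atTop (𝓝 (G'' p)))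
    (p : Sites₀ t A) : G'' p = G p + G' p := by
  have heq : ∀ V, U'' V = U V + U' V :=
    fun V => galerkin_add hA hI hκ hPS (hU V).1 (hU' V).1 (hU'' V).1 (hU V).2 (hU' V).2 (hU'' V).2
  have h1 : Tendsto (fun V : Finset (Sites₀ t A) => U'' V p) atTop (𝓝 (G p + G' p)) := by
    refine ((hG p).add (hG' p)).congr fun V => ?_
    rw [heq V, Pi.add_apply]
  exact tendsto_nhds_unique (hG'' p) h1

/-- **Self-reproduction** (clause (ix)): if `φ` is finitely supported on the sites and `g` is (rowwise, `HasSum`)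
`L φ`, the Galerkin family of `g` is eventually `φ`, so its limit is `φ`. [folklore] -/
theorem lim_eq_of_finite (hA : Adm₀ A) (hI : Inner₀ t A) (hκ : 0 < κ) (hPS : Blowdown.PSIneq κ t A)
    {φ : EuclideanSpace ℝ (Fin 3) → EuclideanSpace ℝ (Fin 3)} (hφ : (Function.support φ).Finite)
    (hφS : Function.support φ ⊆ Sites₀ t A) {g : EuclideanSpace ℝ (Fin 3) → EuclideanSpace ℝ (Fin 3)}
    (hg : ∀ p : Sites₀ t A,
      HasSum (fun q : Sites₀ t A => forceConst ((p : EuclideanSpace ℝ (Fin 3)) - q) (φ p - φ q)) (g p))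
    {U : Finset (Sites₀ t A) → EuclideanSpace ℝ (Fin 3) → EuclideanSpace ℝ (Fin 3)}
    (hU : ∀ V : Finset (Sites₀ t A), Function.support (U V) ⊆ Subtype.val '' (V : Set (Sites₀ t A)) ∧
      ∀ p : Sites₀ t A, p ∈ V →
        ∑' q : Sites₀ t A, forceConst ((p : EuclideanSpace ℝ (Fin 3)) - q) (U V p - U V q) = g p)
    {G : EuclideanSpace ℝ (Fin 3) → EuclideanSpace ℝ (Fin 3)}
    (hG : ∀ p : Sites₀ t A, Tendsto (fun V : Finset (Sites₀ t A) => U V p) atTop (𝓝 (G p))) (p : Sites₀ t A) :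
    G p = φ p := by
  set T := (finite_support_sites (t := t) (A := A) hφ).toFinset with hT
  have hφT : Function.support φ ⊆ Subtype.val '' (T : Set (Sites₀ t A)) := by
    intro x hx
    refine ⟨⟨x, hφS hx⟩, ?_, rfl⟩
    rw [Finset.mem_coe, hT, Set.Finite.mem_toFinset]
    exact hx
  have hrow : ∀ q : Sites₀ t A,
      ∑' r : Sites₀ t A, forceConst ((q : EuclideanSpace ℝ (Fin 3)) - r) (φ q - φ r) = g q := fun q => (hg q).tsum_eq
  have hev : ∀ᶠ V : Finset (Sites₀ t A) in atTop, φ p = U V p := by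
    filter_upwards [eventually_ge_atTop T] with V hV
    have hφV : Function.support φ ⊆ Subtype.val '' (V : Set (Sites₀ t A)) :=
      hφT.trans (Set.image_mono (Finset.coe_subset.2 hV))
    rw [galerkin_unique hA hI hκ hPS (hU V).1 hφV (hU V).2 (fun q _ => hrow q)]
  exact tendsto_nhds_unique (hG p) (tendsto_const_nhds.congr' hev)

/-- **Covariance under lattice translations** (clause (vi)): the Galerkin family of `f(· − Ae)` on `V` is the
Galerkin family of `f` on `V − Ae`, translated; `V ↦ V − Ae` is cofinal, so the limits agree: `G' p = G (p − Ae)`.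
[folklore] -/
theorem lim_translate (hA : Adm₀ A) (hI : Inner₀ t A) (hκ : 0 < κ) (hPS : Blowdown.PSIneq κ t A)
    {f : EuclideanSpace ℝ (Fin 3) → EuclideanSpace ℝ (Fin 3)} {e : EuclideanSpace ℝ (Fin 3)} (he : e ∈ Λ₀)
    {U U' : Finset (Sites₀ t A) → EuclideanSpace ℝ (Fin 3) → EuclideanSpace ℝ (Fin 3)}
    (hU : ∀ V : Finset (Sites₀ t A), Function.support (U V) ⊆ Subtype.val '' (V : Set (Sites₀ t A)) ∧
      ∀ p : Sites₀ t A, p ∈ V →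
        ∑' q : Sites₀ t A, forceConst ((p : EuclideanSpace ℝ (Fin 3)) - q) (U V p - U V q) = f p)
    (hU' : ∀ V : Finset (Sites₀ t A), Function.support (U' V) ⊆ Subtype.val '' (V : Set (Sites₀ t A)) ∧
      ∀ p : Sites₀ t A, p ∈ V →
        ∑' q : Sites₀ t A, forceConst ((p : EuclideanSpace ℝ (Fin 3)) - q) (U' V p - U' V q) =
          f ((p : EuclideanSpace ℝ (Fin 3)) - A e))
    {G G' : EuclideanSpace ℝ (Fin 3) → EuclideanSpace ℝ (Fin 3)}
    (hG : ∀ p : Sites₀ t A, Tendsto (fun V : Finset (Sites₀ t A) => U V p) atTop (𝓝 (G p)))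
    (hG' : ∀ p : Sites₀ t A, Tendsto (fun V : Finset (Sites₀ t A) => U' V p) atTop (𝓝 (G' p))) (p : Sites₀ t A) :
    G' p = G ((p : EuclideanSpace ℝ (Fin 3)) - A e) := by
  obtain ⟨σ, hσ⟩ := exists_sitesShift (t := t) (A := A) he
  have hσ' : ∀ q : Sites₀ t A, ((σ.symm q : Sites₀ t A) : EuclideanSpace ℝ (Fin 3)) = q - A e := by
    intro q
    have h := hσ (σ.symm q)
    rw [Equiv.apply_symm_apply] at h
    rw [eq_sub_iff_add_eq, ← h]
  -- the translated family is the Galerkin family of the translated right-hand side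
  have hlevel : ∀ V : Finset (Sites₀ t A), U' V = fun x => U (V.image σ.symm) (x - A e) := by
    intro V
    refine galerkin_unique hA hI hκ hPS (f := fun x => f (x - A e)) (hU' V).1 ?_ (hU' V).2 ?_
    · intro x hx
      obtain ⟨w, hw, hwx⟩ := (hU (V.image σ.symm)).1 hx
      rw [Finset.coe_image] at hw
      obtain ⟨v, hv, rfl⟩ := hw
      rw [hσ'] at hwx
      exact ⟨v, hv, by simpa using hwx⟩
    · intro q hq
      have hq' : σ.symm q ∈ V.image σ.symm := Finset.mem_image_of_mem _ hq
      have hrow := (hU (V.image σ.symm)).2 (σ.symm q) hq'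
      rw [hσ'] at hrow
      rw [← hrow, ← σ.tsum_eq]
      refine tsum_congr fun r => ?_
      simp only [hσ r, add_sub_cancel_right]
      congr 1
      abel
  -- cofinality of the translated exhaustion
  have hcof : Tendsto (fun V : Finset (Sites₀ t A) => V.image σ.symm) atTop atTop :=
    tendsto_finset_image_atTop_atTop (i := σ) fun x => σ.symm_apply_apply x
  have h1 : Tendsto (fun V : Finset (Sites₀ t A) => U' V p) atTop (𝓝 (G ((p : EuclideanSpace ℝ (Fin 3)) - A e))) := by
    have h := (hG (σ.symm p)).comp hcof
    rw [hσ'] at h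
    refine h.congr fun V => ?_
    simp only [Function.comp_apply, hlevel V]
  exact tendsto_nhds_unique (hG' p) h1

/-! ## Countable additivity (clause (viii)) -/

/-- **Countable additivity at the finite level**: if `Σ_n F n = f` pointwise on the sites (`HasSum`), the Galerkin
solutions on a fixed finite set `V` satisfy `Σ_n u_V[F n] p = u_V[f] p` (the solution map is a linear map of the
finitely many data `f|_V`, hence continuous). [folklore] -/
theorem hasSum_galerkin_level (hA : Adm₀ A) (hI : Inner₀ t A) (hκ : 0 < κ) (hPS : Blowdown.PSIneq κ t A)
    (V : Finset (Sites₀ t A)) {ι : Type} {F : ι → EuclideanSpace ℝ (Fin 3) → EuclideanSpace ℝ (Fin 3)}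
    {f : EuclideanSpace ℝ (Fin 3) → EuclideanSpace ℝ (Fin 3)}
    {UF : ι → EuclideanSpace ℝ (Fin 3) → EuclideanSpace ℝ (Fin 3)} {Uf : EuclideanSpace ℝ (Fin 3) → EuclideanSpace ℝ (Fin 3)}
    (hUF : ∀ n, Function.support (UF n) ⊆ Subtype.val '' (V : Set (Sites₀ t A)) ∧
      ∀ p : Sites₀ t A, p ∈ V →
        ∑' q : Sites₀ t A, forceConst ((p : EuclideanSpace ℝ (Fin 3)) - q) (UF n p - UF n q) = F n p)
    (hUf : Function.support Uf ⊆ Subtype.val '' (V : Set (Sites₀ t A)) ∧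
      ∀ p : Sites₀ t A, p ∈ V →
        ∑' q : Sites₀ t A, forceConst ((p : EuclideanSpace ℝ (Fin 3)) - q) (Uf p - Uf q) = f p)
    (hsum : ∀ p : Sites₀ t A, HasSum (fun n => F n p) (f p)) (p : Sites₀ t A) :
    HasSum (fun n => UF n p) (Uf p) := by
  -- extension by zero of data on `V`
  obtain ⟨ext, hext⟩ : ∃ ext : (V → EuclideanSpace ℝ (Fin 3)) → EuclideanSpace ℝ (Fin 3) → EuclideanSpace ℝ (Fin 3),
      ∀ (b : V → EuclideanSpace ℝ (Fin 3)) (q : Sites₀ t A) (hq : q ∈ V), ext b q = b ⟨q, hq⟩ := by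
    refine ⟨fun b x => if h : ∃ hx : x ∈ Sites₀ t A, (⟨x, hx⟩ : Sites₀ t A) ∈ V then b ⟨⟨x, h.1⟩, h.2⟩ else 0,
      fun b q hq => ?_⟩
    have h : ∃ hx : (q : EuclideanSpace ℝ (Fin 3)) ∈ Sites₀ t A, (⟨q, hx⟩ : Sites₀ t A) ∈ V := ⟨q.2, by simpa using hq⟩
    simp only [dif_pos h]
  -- Galerkin solutions of the extended data
  obtain ⟨sol, hsol⟩ : ∃ sol : (V → EuclideanSpace ℝ (Fin 3)) → EuclideanSpace ℝ (Fin 3) → EuclideanSpace ℝ (Fin 3),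
      ∀ b, Function.support (sol b) ⊆ Subtype.val '' (V : Set (Sites₀ t A)) ∧
        ∀ q : Sites₀ t A, q ∈ V →
          ∑' r : Sites₀ t A, forceConst ((q : EuclideanSpace ℝ (Fin 3)) - r) (sol b q - sol b r) = ext b q :=
    ⟨fun b => Classical.choose (exists_galerkin hA hI hκ hPS V (ext b)),
      fun b => Classical.choose_spec (exists_galerkin hA hI hκ hPS V (ext b))⟩
  -- the solution map evaluated at `p` is linear
  let Ψ : (V → EuclideanSpace ℝ (Fin 3)) →ₗ[ℝ] EuclideanSpace ℝ (Fin 3) :=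
    { toFun := fun b => sol b p
      map_add' := fun b₁ b₂ => by
        have h := galerkin_add hA hI hκ hPS (hsol b₁).1 (hsol b₂).1 (hsol (b₁ + b₂)).1 (hsol b₁).2 (hsol b₂).2
          (fun q hq => by
            rw [(hsol (b₁ + b₂)).2 q hq, Pi.add_apply, hext (b₁ + b₂) q hq, hext b₁ q hq, hext b₂ q hq,
              Pi.add_apply])
        show sol (b₁ + b₂) p = sol b₁ p + sol b₂ p
        rw [h, Pi.add_apply]
      map_smul' := fun c b => by
        have h := galerkin_smul hA hI hκ hPS c (hsol b).1 (hsol (c • b)).1 (hsol b).2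
          (fun q hq => by rw [(hsol (c • b)).2 q hq, Pi.smul_apply, hext (c • b) q hq, hext b q hq, Pi.smul_apply])
        show sol (c • b) p = c • sol b p
        rw [h, Pi.smul_apply] }
  let Ψc : (V → EuclideanSpace ℝ (Fin 3)) →L[ℝ] EuclideanSpace ℝ (Fin 3) := ⟨Ψ, Ψ.continuous_of_finiteDimensional⟩
  have hΨc : ∀ b, Ψc b = sol b p := fun b => rfl
  -- the vector-valued `HasSum` of the data, mapped by the solution map
  have hvec : HasSum (fun n => fun x : V => F n ((x : Sites₀ t A) : EuclideanSpace ℝ (Fin 3)))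
      (fun x : V => f ((x : Sites₀ t A) : EuclideanSpace ℝ (Fin 3))) :=
    Pi.hasSum.2 fun x => hsum x
  have hmap := hvec.mapL Ψc
  -- identify the values with the given Galerkin solutions
  have hid : ∀ (g u : EuclideanSpace ℝ (Fin 3) → EuclideanSpace ℝ (Fin 3)),
      Function.support u ⊆ Subtype.val '' (V : Set (Sites₀ t A)) →
      (∀ q : Sites₀ t A, q ∈ V →
        ∑' r : Sites₀ t A, forceConst ((q : EuclideanSpace ℝ (Fin 3)) - r) (u q - u r) = g q) →
      sol (fun x : V => g ((x : Sites₀ t A) : EuclideanSpace ℝ (Fin 3))) = u := by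
    intro g u hu hru
    exact galerkin_congr hA hI hκ hPS (hsol _).1 hu (hsol _).2 hru (fun q hq => by rw [hext _ q hq])
  have h1 : ∀ n, Ψc (fun x : V => F n ((x : Sites₀ t A) : EuclideanSpace ℝ (Fin 3))) = UF n p := fun n => by
    rw [hΨc, hid (F n) (UF n) (hUF n).1 (hUF n).2]
  have h2 : Ψc (fun x : V => f ((x : Sites₀ t A) : EuclideanSpace ℝ (Fin 3))) = Uf p := by
    rw [hΨc, hid f Uf hUf.1 hUf.2]
  simpa only [h1, h2] using hmap

/-- **Countable additivity of the limits** (clause (viii)): Tannery along the net of finite sets of sites, with the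
capacity domination `‖U V p‖ ≤ √C · Nₙ/κ`. [folklore] -/
theorem hasSum_lim (hA : Adm₀ A) (hI : Inner₀ t A) (hκ : 0 < κ) (hPS : Blowdown.PSIneq κ t A)
    {ι : Type} {F : ι → EuclideanSpace ℝ (Fin 3) → EuclideanSpace ℝ (Fin 3)} {Nn : ι → ℝ}
    {f : EuclideanSpace ℝ (Fin 3) → EuclideanSpace ℝ (Fin 3)}
    (hNn : ∀ n, 0 ≤ Nn n) (hsNn : Summable Nn)
    (hF : ∀ n, ∀ w : EuclideanSpace ℝ (Fin 3) → EuclideanSpace ℝ (Fin 3), (Function.support w).Finite →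
      Function.support w ⊆ Sites₀ t A → |∑' p : Sites₀ t A, ⟪F n p, w p⟫| ≤ Nn n * Real.sqrt (nnForm t A w))
    {UF : ι → Finset (Sites₀ t A) → EuclideanSpace ℝ (Fin 3) → EuclideanSpace ℝ (Fin 3)}
    {Uf : Finset (Sites₀ t A) → EuclideanSpace ℝ (Fin 3) → EuclideanSpace ℝ (Fin 3)}
    (hUF : ∀ n (V : Finset (Sites₀ t A)), Function.support (UF n V) ⊆ Subtype.val '' (V : Set (Sites₀ t A)) ∧
      ∀ p : Sites₀ t A, p ∈ V →
        ∑' q : Sites₀ t A, forceConst ((p : EuclideanSpace ℝ (Fin 3)) - q) (UF n V p - UF n V q) = F n p)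
    (hUf : ∀ V : Finset (Sites₀ t A), Function.support (Uf V) ⊆ Subtype.val '' (V : Set (Sites₀ t A)) ∧
      ∀ p : Sites₀ t A, p ∈ V →
        ∑' q : Sites₀ t A, forceConst ((p : EuclideanSpace ℝ (Fin 3)) - q) (Uf V p - Uf V q) = f p)
    (hC : 0 ≤ C)
    (hcap : ∀ w : EuclideanSpace ℝ (Fin 3) → EuclideanSpace ℝ (Fin 3), (Function.support w).Finite →
      Function.support w ⊆ Sites₀ t A → ∀ p ∈ Sites₀ t A, ‖w p‖ ^ 2 ≤ C * nnForm t A w)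
    {GF : ι → EuclideanSpace ℝ (Fin 3) → EuclideanSpace ℝ (Fin 3)} {Gf : EuclideanSpace ℝ (Fin 3) → EuclideanSpace ℝ (Fin 3)}
    (hGF : ∀ n (p : Sites₀ t A), Tendsto (fun V : Finset (Sites₀ t A) => UF n V p) atTop (𝓝 (GF n p)))
    (hGf : ∀ p : Sites₀ t A, Tendsto (fun V : Finset (Sites₀ t A) => Uf V p) atTop (𝓝 (Gf p)))
    (hsum : ∀ p : Sites₀ t A, HasSum (fun n => F n p) (f p)) (p : Sites₀ t A) :
    HasSum (fun n => GF n p) (Gf p) := by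
  set bound : ι → ℝ := fun n => Real.sqrt C * (Nn n / κ) with hbound
  have hbs : Summable bound := (hsNn.div_const κ).mul_left _
  have hdom : ∀ (V : Finset (Sites₀ t A)) (n : ι), ‖UF n V p‖ ≤ bound n :=
    fun V n => norm_galerkin_le hA hI hκ hPS (hNn n) (hF n) (hUF n V).1 (hUF n V).2 hC hcap p
  have hT := tendsto_tsum_of_dominated_convergence (𝓕 := (atTop : Filter (Finset (Sites₀ t A))))
    (f := fun V n => UF n V p) hbs (fun n => hGF n p) (Eventually.of_forall hdom)
  have hlev : ∀ V : Finset (Sites₀ t A), ∑' n, UF n V p = Uf V p :=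
    fun V => (hasSum_galerkin_level hA hI hκ hPS V (fun n => hUF n V) (hUf V) hsum p).tsum_eq
  have hT' : Tendsto (fun V : Finset (Sites₀ t A) => ∑' n, UF n V p) atTop (𝓝 (Gf p)) :=
    (hGf p).congr fun V => (hlev V).symm
  have heq : ∑' n, GF n p = Gf p := tendsto_nhds_unique hT hT'
  have hgb : ∀ n, ‖GF n p‖ ≤ bound n :=
    fun n => le_of_tendsto (tendsto_norm.comp (hGF n p)) (Eventually.of_forall fun V => hdom V n)
  have hs : Summable (fun n => GF n p) := hbs.of_norm_bounded hgb
  rw [← heq]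
  exact hs.hasSum

end

/-- Registered helper of sub-goal `blowdown_greenSolve` (H2 of stub `stub_green`, crux stmt-AtomisticToContinuum-9332,
line `Sketch` v4): self-reproduction — the pointwise limit of the Galerkin family of `L φ` (`φ` finitely supported on
the sites) is `φ`. [folklore] -/
theorem blowdown_galerkinLinear : ∀ (κ : ℝ) (t : Fin 2 → (EuclideanSpace ℝ (Fin 3))) (A : (EuclideanSpace ℝ (Fin 3)) →L[ℝ] (EuclideanSpace ℝ (Fin 3))), 0 < κ → Adm₀ A → Inner₀ t A → Blowdown.PSIneq κ t A → ∀ (φ g : (EuclideanSpace ℝ (Fin 3)) → (EuclideanSpace ℝ (Fin 3))) (U : Finset (Sites₀ t A) → (EuclideanSpace ℝ (Fin 3)) → (EuclideanSpace ℝ (Fin 3))) (G : (EuclideanSpace ℝ (Fin 3)) → (EuclideanSpace ℝ (Fin 3))), (Function.support φ).Finite → Function.support φ ⊆ Sites₀ t A → (∀ p : Sites₀ t A, HasSum (fun q : Sites₀ t A => forceConst ((p : (EuclideanSpace ℝ (Fin 3))) - q) (φ p - φ q)) (g p)) → (∀ V : Finset (Sites₀ t A), Function.support (U V) ⊆ Subtype.val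 '' (V : Set (Sites₀ t A)) ∧ ∀ p : Sites₀ t A, p ∈ V → ∑' q : Sites₀ t A, forceConst ((p : (EuclideanSpace ℝ (Fin 3))) - q) (U V p - U V q) = g p) → (∀ p : Sites₀ t A, Filter.Tendsto (fun V : Finset (Sites₀ t A) => U V p) Filter.atTop (nhds (G p))) → ∀ p : Sites₀ t A, G p = φ p :=
  fun _ _ _ hκ hA hI hPS _ _ _ _ hφ hφS hg hU hG p => lim_eq_of_finite hA hI hκ hPS hφ hφS hg hU hG p

end Summit.AtomisticToContinuum.Crystallization.Theorems.ExcessDecayLiouville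

end
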